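import Summits.KontsevichZagierPeriods.KontsevichZagierPeriods.Theses.SymplecticScissors
import Literature.NumberTheory.Transcendental.KZIntervalPeriodProofs

/-!
# `CurvePeriodsTransfer` (stmt-KontsevichZagierPeriods-11129) — negative knowledge, part 2: the Green generator of the consequent is SOUND

Support file for the crux `SymplecticScissors.CurvePeriodsTransfer` and its sibling
`SymplecticScissors.RealOnePeriodRelations` (cdisprove seat of 11129, cycle 1; work file
`Cruxes/CurvePeriodsTransfer/Disproof.lean`). The conclusion subgroup of `RealOnePeriodRelations` (the
consequent of the crux, also the antecedent of `PlanarCompiler`) is generated by rules 1a, 1b, 2 — whose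
soundness is discharged in the tree (`KZ.eval_eq_zero_of_mem_*_holds`) — and by the GREEN GENERATOR
`[∫₀¹ A(t,0)] + [∫₀¹ (B−A)(1−t,t)] − [∫₀¹ B(0,t)]` for `A, B` `ℚ`-semialgebraic and continuous on the CLOSED
standard triangle with a `C¹` potential `S` (`dS = A da + B db`) on the OPEN triangle only. This file proves
that generator sound at the level of interval integrals (`green_identity`) and of values of
1-dimensional representations (`value_eq_intervalIntegral`): FTC along the three edges of the shrunken
triangles `(x,x), (1−2x,x), (x,1−2x)`, `0 < x < 1/3`, which lie in the open triangle, then `x → 0` by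
continuity of the parametric integrals of the CLAMPED edges (clamping makes the integrands globally jointly
continuous, so Mathlib's `continuous_parametric_intervalIntegral_of_continuous'` applies; no extension of
`S` to the boundary is needed). Part 3 (`Consequent.lean`) turns this into `M₁ ≤ ker eval` and the
load-bearing analysis of the consequent. [folklore]
-/

noncomputable section

open scoped BigOperators
open Set MeasureTheory MvPolynomial intervalIntegral
open Literature.NumberTheory.Transcendental

namespace Summit.KontsevichZagierPeriods.SymplecticScissors.CurvePeriodsTransferNegative

/-! ## Green's identity for typed Green data -/

section GreenSound

/-- The closed standard triangle in `ℝ²` (as a subset of `Fin 2 → ℝ`). [folklore] -/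
def Δc : Set (Fin 2 → ℝ) := {p | 0 ≤ p 0 ∧ 0 ≤ p 1 ∧ p 0 + p 1 ≤ 1}

/-- Clamp to `[0, 1/3]`. [folklore] -/
def c3 (x : ℝ) : ℝ := max 0 (min x (1 / 3))

/-- Clamp to `[0, 1]`. [folklore] -/
def c1 (t : ℝ) : ℝ := max 0 (min t 1)

/-- The clamp `c3` is non-negative. [folklore] -/
theorem c3_nonneg (x : ℝ) : 0 ≤ c3 x := le_max_left _ _

/-- The clamp `c3` is at most `1/3`. [folklore] -/
theorem c3_le (x : ℝ) : c3 x ≤ 1 / 3 := max_le (by norm_num) (min_le_right _ _)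

/-- The clamp `c1` is non-negative. [folklore] -/
theorem c1_nonneg (t : ℝ) : 0 ≤ c1 t := le_max_left _ _

/-- The clamp `c1` is at most `1`. [folklore] -/
theorem c1_le (t : ℝ) : c1 t ≤ 1 := max_le (by norm_num) (min_le_right _ _)

/-- The clamp `c3` is continuous. [folklore] -/
@[fun_prop]
theorem continuous_c3 : Continuous c3 := continuous_const.max (continuous_id.min continuous_const)

/-- The clamp `c1` is continuous. [folklore] -/
@[fun_prop]
theorem continuous_c1 : Continuous c1 := continuous_const.max (continuous_id.min continuous_const)

/-- On `[0, 1/3]` the clamp `c3` is the identity. [folklore] -/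
theorem c3_of_mem {x : ℝ} (hx : x ∈ Icc (0 : ℝ) (1 / 3)) : c3 x = x := by
  unfold c3
  rw [min_eq_left hx.2, max_eq_right hx.1]

/-- On `[0, 1]` the clamp `c1` is the identity. [folklore] -/
theorem c1_of_mem {t : ℝ} (ht : t ∈ Icc (0 : ℝ) 1) : c1 t = t := by
  unfold c1
  rw [min_eq_left ht.2, max_eq_right ht.1]

/-- Clamped edge `v₀ → v₁` of the shrunken triangle `(x,x), (1−2x,x), (x,1−2x)` (parameter clamped to `[0,1/3]`, time to `[0,1]`). [folklore] -/
def P01 (x t : ℝ) : Fin 2 → ℝ := ![c3 x + (1 - 3 * c3 x) * c1 t, c3 x]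

/-- Clamped edge `v₁ → v₂` of the shrunken triangle. [folklore] -/
def P12 (x t : ℝ) : Fin 2 → ℝ := ![1 - 2 * c3 x - (1 - 3 * c3 x) * c1 t, c3 x + (1 - 3 * c3 x) * c1 t]

/-- Clamped edge `v₀ → v₂` of the shrunken triangle. [folklore] -/
def P02 (x t : ℝ) : Fin 2 → ℝ := ![c3 x, c3 x + (1 - 3 * c3 x) * c1 t]

/-- The clamped edge `P01` is jointly continuous. [folklore] -/
theorem continuous_P01 : Continuous fun q : ℝ × ℝ => P01 q.1 q.2 := by
  refine continuous_pi fun i => ?_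
  fin_cases i
  · simp only [P01, Fin.zero_eta, Matrix.cons_val_zero]
    fun_prop
  · simp only [P01, Fin.mk_one, Matrix.cons_val_one, Matrix.cons_val_zero]
    fun_prop

/-- The clamped edge `P12` is jointly continuous. [folklore] -/
theorem continuous_P12 : Continuous fun q : ℝ × ℝ => P12 q.1 q.2 := by
  refine continuous_pi fun i => ?_
  fin_cases i
  · simp only [P12, Fin.zero_eta, Matrix.cons_val_zero]
    fun_prop
  · simp only [P12, Fin.mk_one, Matrix.cons_val_one, Matrix.cons_val_zero]
    fun_prop

/-- The clamped edge `P02` is jointly continuous. [folklore] -/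
theorem continuous_P02 : Continuous fun q : ℝ × ℝ => P02 q.1 q.2 := by
  refine continuous_pi fun i => ?_
  fin_cases i
  · simp only [P02, Fin.zero_eta, Matrix.cons_val_zero]
    fun_prop
  · simp only [P02, Fin.mk_one, Matrix.cons_val_one, Matrix.cons_val_zero]
    fun_prop

/-- The clamped edge `P01` stays in the closed triangle. [folklore] -/
theorem P01_mem (x t : ℝ) : P01 x t ∈ Δc := by
  have h1 := c3_nonneg x; have h2 := c3_le x; have h3 := c1_nonneg t; have h4 := c1_le t
  simp only [Δc, P01, mem_setOf_eq, Matrix.cons_val_zero, Matrix.cons_val_one]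
  refine ⟨by nlinarith [mul_nonneg (sub_nonneg.2 (by linarith : 3 * c3 x ≤ 1)) h3], h1, ?_⟩
  nlinarith [mul_nonneg (sub_nonneg.2 (by linarith : 3 * c3 x ≤ 1)) (sub_nonneg.2 h4)]

/-- The clamped edge `P12` stays in the closed triangle. [folklore] -/
theorem P12_mem (x t : ℝ) : P12 x t ∈ Δc := by
  have h1 := c3_nonneg x; have h2 := c3_le x; have h3 := c1_nonneg t; have h4 := c1_le t
  simp only [Δc, P12, mem_setOf_eq, Matrix.cons_val_zero, Matrix.cons_val_one]
  refine ⟨?_, by nlinarith [mul_nonneg (sub_nonneg.2 (by linarith : 3 * c3 x ≤ 1)) h3], by nlinarith⟩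
  nlinarith [mul_nonneg (sub_nonneg.2 (by linarith : 3 * c3 x ≤ 1)) (sub_nonneg.2 h4)]

/-- The clamped edge `P02` stays in the closed triangle. [folklore] -/
theorem P02_mem (x t : ℝ) : P02 x t ∈ Δc := by
  have h1 := c3_nonneg x; have h2 := c3_le x; have h3 := c1_nonneg t; have h4 := c1_le t
  simp only [Δc, P02, mem_setOf_eq, Matrix.cons_val_zero, Matrix.cons_val_one]
  refine ⟨h1, by nlinarith [mul_nonneg (sub_nonneg.2 (by linarith : 3 * c3 x ≤ 1)) h3], ?_⟩
  nlinarith [mul_nonneg (sub_nonneg.2 (by linarith : 3 * c3 x ≤ 1)) (sub_nonneg.2 h4)]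

/-- The boundary functional of the clamped shrunken triangle: bottom + hypotenuse − left edge integrals of the Green data (without the common factor `1 − 3x`). [folklore] -/
def G (A B : (Fin 2 → ℝ) → ℝ) (x : ℝ) : ℝ :=
  (∫ t in (0 : ℝ)..1, A (P01 x t)) + (∫ t in (0 : ℝ)..1, (B (P12 x t) - A (P12 x t))) -
    ∫ t in (0 : ℝ)..1, B (P02 x t)

variable {A B S : (Fin 2 → ℝ) → ℝ}

/-- The boundary functional `G` is continuous in the shrinking parameter (parametric interval integrals of jointly continuous integrands). [folklore] -/
theorem continuous_G (hA : ContinuousOn A Δc) (hB : ContinuousOn B Δc) : Continuous (G A B) := by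
  have h1 : Continuous (Function.uncurry fun x t => A (P01 x t)) :=
    hA.comp_continuous continuous_P01 fun q => P01_mem q.1 q.2
  have h2 : Continuous (Function.uncurry fun x t => B (P12 x t) - A (P12 x t)) :=
    (hB.comp_continuous continuous_P12 fun q => P12_mem q.1 q.2).sub
      (hA.comp_continuous continuous_P12 fun q => P12_mem q.1 q.2)
  have h3 : Continuous (Function.uncurry fun x t => B (P02 x t)) :=
    hB.comp_continuous continuous_P02 fun q => P02_mem q.1 q.2
  unfold G
  exact ((intervalIntegral.continuous_parametric_intervalIntegral_of_continuous' h1 0 1).add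
    (intervalIntegral.continuous_parametric_intervalIntegral_of_continuous' h2 0 1)).sub
    (intervalIntegral.continuous_parametric_intervalIntegral_of_continuous' h3 0 1)

/-- At parameter `0` the boundary functional is the boundary combination of the Green generator. [folklore] -/
theorem G_zero (A B : (Fin 2 → ℝ) → ℝ) :
    G A B 0 = (∫ t in (0 : ℝ)..1, A ![t, 0]) + (∫ t in (0 : ℝ)..1, (B ![1 - t, t] - A ![1 - t, t])) -
      ∫ t in (0 : ℝ)..1, B ![0, t] := by
  have h3 : c3 0 = 0 := c3_of_mem ⟨le_rfl, by norm_num⟩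
  have e1 : ∀ t ∈ uIcc (0 : ℝ) 1, P01 0 t = ![t, 0] := fun t ht => by
    rw [uIcc_of_le zero_le_one] at ht
    ext i; fin_cases i <;> simp [P01, h3, c1_of_mem ht]
  have e2 : ∀ t ∈ uIcc (0 : ℝ) 1, P12 0 t = ![1 - t, t] := fun t ht => by
    rw [uIcc_of_le zero_le_one] at ht
    ext i; fin_cases i <;> simp [P12, h3, c1_of_mem ht]
  have e3 : ∀ t ∈ uIcc (0 : ℝ) 1, P02 0 t = ![0, t] := fun t ht => by
    rw [uIcc_of_le zero_le_one] at ht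
    ext i; fin_cases i <;> simp [P02, h3, c1_of_mem ht]
  unfold G
  rw [intervalIntegral.integral_congr fun t ht => show A (P01 0 t) = A ![t, 0] by rw [e1 t ht],
    intervalIntegral.integral_congr fun t ht =>
      show B (P12 0 t) - A (P12 0 t) = B ![1 - t, t] - A ![1 - t, t] by rw [e2 t ht],
    intervalIntegral.integral_congr fun t ht => show B (P02 0 t) = B ![0, t] by rw [e3 t ht]]

/-- The linear form `A p · da + B p · db` of the Green data (the `HasFDerivAt` target of the typed generator). [folklore] -/
abbrev Lform (A B : (Fin 2 → ℝ) → ℝ) (p : Fin 2 → ℝ) : (Fin 2 → ℝ) →L[ℝ] ℝ :=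
  A p • ContinuousLinearMap.proj (R := ℝ) (φ := fun _ : Fin 2 => ℝ) 0 +
    B p • ContinuousLinearMap.proj (R := ℝ) (φ := fun _ : Fin 2 => ℝ) 1

/-- Evaluation of the linear form of the Green data. [folklore] -/
theorem Lform_apply (A B : (Fin 2 → ℝ) → ℝ) (p v : Fin 2 → ℝ) :
    Lform A B p v = A p * v 0 + B p * v 1 := by
  simp [Lform]

/-- FTC along an affine segment inside the OPEN triangle: `∫₀¹ (A·a₁ + B·b₁)(segment) = S(end) − S(start)`. [folklore] -/
theorem integral_affine_eq (hA : ContinuousOn A Δc) (hB : ContinuousOn B Δc)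
    (hS : ∀ p : Fin 2 → ℝ, 0 < p 0 → 0 < p 1 → p 0 + p 1 < 1 → HasFDerivAt S (Lform A B p) p)
    (a₀ a₁ b₀ b₁ : ℝ)
    (hopen : ∀ t ∈ Icc (0 : ℝ) 1,
      0 < a₀ + a₁ * t ∧ 0 < b₀ + b₁ * t ∧ (a₀ + a₁ * t) + (b₀ + b₁ * t) < 1) :
    ∫ t in (0 : ℝ)..1, (A ![a₀ + a₁ * t, b₀ + b₁ * t] * a₁ + B ![a₀ + a₁ * t, b₀ + b₁ * t] * b₁) =
      S ![a₀ + a₁ * 1, b₀ + b₁ * 1] - S ![a₀ + a₁ * 0, b₀ + b₁ * 0] := by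
  set Q : ℝ → Fin 2 → ℝ := fun t => ![a₀ + a₁ * t, b₀ + b₁ * t] with hQ
  have hQd : ∀ t, HasDerivAt Q ![a₁, b₁] t := by
    intro t
    rw [hasDerivAt_pi]
    intro i
    fin_cases i
    · simp only [hQ, Fin.zero_eta, Matrix.cons_val_zero]
      simpa using ((hasDerivAt_id t).const_mul a₁).const_add a₀
    · simp only [hQ, Fin.mk_one, Matrix.cons_val_one, Matrix.cons_val_zero]
      simpa using ((hasDerivAt_id t).const_mul b₁).const_add b₀
  have hmemc : ∀ t ∈ Icc (0 : ℝ) 1, Q t ∈ Δc := fun t ht => by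
    obtain ⟨h1, h2, h3⟩ := hopen t ht
    simp only [Δc, hQ, mem_setOf_eq, Matrix.cons_val_zero, Matrix.cons_val_one]
    exact ⟨h1.le, h2.le, h3.le⟩
  have hQc : Continuous Q := continuous_pi fun i => by
    fin_cases i
    · simp only [hQ, Fin.zero_eta, Matrix.cons_val_zero]; fun_prop
    · simp only [hQ, Fin.mk_one, Matrix.cons_val_one, Matrix.cons_val_zero]; fun_prop
  have hderiv : ∀ t ∈ uIcc (0 : ℝ) 1,
      HasDerivAt (S ∘ Q) (A (Q t) * a₁ + B (Q t) * b₁) t := by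
    intro t ht
    rw [uIcc_of_le zero_le_one] at ht
    obtain ⟨h1, h2, h3⟩ := hopen t ht
    have hSQ : HasFDerivAt S (Lform A B (Q t)) (Q t) := by
      refine hS (Q t) ?_ ?_ ?_ <;>
        simp only [hQ, Matrix.cons_val_zero, Matrix.cons_val_one] <;> assumption
    have := hSQ.comp_hasDerivAt t (hQd t)
    refine this.congr_deriv ?_
    rw [Lform_apply]
    simp
  have hint : IntervalIntegrable (fun t => A (Q t) * a₁ + B (Q t) * b₁) volume 0 1 := by
    refine ContinuousOn.intervalIntegrable ?_
    rw [uIcc_of_le zero_le_one]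
    exact ((hA.comp hQc.continuousOn hmemc).mul continuousOn_const).add
      ((hB.comp hQc.continuousOn hmemc).mul continuousOn_const)
  have := intervalIntegral.integral_eq_sub_of_hasDerivAt hderiv hint
  simpa [hQ, Function.comp] using this

/-- For `0 < x < 1/3` the boundary functional vanishes: the three FTC identities along the edges of the shrunken triangle telescope. [folklore] -/
theorem G_eq_zero_of_mem (hA : ContinuousOn A Δc) (hB : ContinuousOn B Δc)
    (hS : ∀ p : Fin 2 → ℝ, 0 < p 0 → 0 < p 1 → p 0 + p 1 < 1 → HasFDerivAt S (Lform A B p) p)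
    {x : ℝ} (hx : x ∈ Ioo (0 : ℝ) (1 / 3)) : G A B x = 0 := by
  obtain ⟨hx0, hx1⟩ := hx
  set k : ℝ := 1 - 3 * x with hk
  have hkpos : 0 < k := by rw [hk]; linarith
  have hc3 : c3 x = x := c3_of_mem ⟨hx0.le, hx1.le⟩
  -- the three edges, unclamped
  have e1 : ∀ t ∈ uIcc (0 : ℝ) 1, A (P01 x t) = A ![x + k * t, x + 0 * t] := fun t ht => by
    rw [uIcc_of_le zero_le_one] at ht
    congr 1; ext i; fin_cases i <;> simp [P01, hc3, c1_of_mem ht, hk]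
  have e2 : ∀ t ∈ uIcc (0 : ℝ) 1, B (P12 x t) - A (P12 x t) =
      B ![(1 - 2 * x) + (-k) * t, x + k * t] - A ![(1 - 2 * x) + (-k) * t, x + k * t] := fun t ht => by
    rw [uIcc_of_le zero_le_one] at ht
    have : P12 x t = ![(1 - 2 * x) + (-k) * t, x + k * t] := by
      ext i; fin_cases i <;> simp [P12, hc3, c1_of_mem ht, hk]; ring
    rw [this]
  have e3 : ∀ t ∈ uIcc (0 : ℝ) 1, B (P02 x t) = B ![x + 0 * t, x + k * t] := fun t ht => by
    rw [uIcc_of_le zero_le_one] at ht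
    congr 1; ext i; fin_cases i <;> simp [P02, hc3, c1_of_mem ht, hk]
  -- FTC on the three edges
  have f1 := integral_affine_eq hA hB hS x k x 0 (fun t ht => by
    refine ⟨by nlinarith [ht.1], by linarith, ?_⟩; nlinarith [ht.2, hk])
  have f2 := integral_affine_eq hA hB hS (1 - 2 * x) (-k) x k (fun t ht => by
    refine ⟨by nlinarith [ht.2, hk], by nlinarith [ht.1], ?_⟩; nlinarith [ht.2, hk])
  have f3 := integral_affine_eq hA hB hS x 0 x k (fun t ht => by
    refine ⟨by linarith, by nlinarith [ht.1], ?_⟩; nlinarith [ht.2, hk])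
  -- assemble: k * G x = telescoping sum of S at the three vertices
  have hv1 : (![x + k * 1, x + 0 * 1] : Fin 2 → ℝ) = ![(1 - 2 * x) + (-k) * 0, x + k * 0] := by
    ext i; fin_cases i <;> simp [hk]; ring
  have hv2 : (![(1 - 2 * x) + (-k) * 1, x + k * 1] : Fin 2 → ℝ) = ![x + 0 * 1, x + k * 1] := by
    ext i; fin_cases i <;> simp [hk]; ring
  have hv3 : (![x + k * 0, x + 0 * 0] : Fin 2 → ℝ) = ![x + 0 * 0, x + k * 0] := by
    ext i; fin_cases i <;> simp
  have hG : k * G A B x = 0 := by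
    unfold G
    rw [intervalIntegral.integral_congr e1, intervalIntegral.integral_congr e2,
      intervalIntegral.integral_congr e3, mul_sub, mul_add,
      ← intervalIntegral.integral_const_mul, ← intervalIntegral.integral_const_mul,
      ← intervalIntegral.integral_const_mul]
    have g1 : ∫ t in (0 : ℝ)..1, k * A ![x + k * t, x + 0 * t] =
        S ![x + k * 1, x + 0 * 1] - S ![x + k * 0, x + 0 * 0] := by
      rw [← f1]; congr 1; ext t; ring
    have g2 : ∫ t in (0 : ℝ)..1, k * (B ![(1 - 2 * x) + (-k) * t, x + k * t] -
        A ![(1 - 2 * x) + (-k) * t, x + k * t]) =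
        S ![(1 - 2 * x) + (-k) * 1, x + k * 1] - S ![(1 - 2 * x) + (-k) * 0, x + k * 0] := by
      rw [← f2]; congr 1; ext t; ring
    have g3 : ∫ t in (0 : ℝ)..1, k * B ![x + 0 * t, x + k * t] =
        S ![x + 0 * 1, x + k * 1] - S ![x + 0 * 0, x + k * 0] := by
      rw [← f3]; congr 1; ext t; ring
    rw [g1, g2, g3, hv1, hv2, hv3]
    ring
  rcases mul_eq_zero.mp hG with h | h
  · exact absurd h hkpos.ne'
  · exact h

/-- **Green's identity on the standard triangle for typed Green data**: `∫₀¹ A(t,0) dt + ∫₀¹ (B − A)(1−t,t) dt − ∫₀¹ B(0,t) dt = 0` for `A, B` continuous on the CLOSED triangle and a potential `S` (`dS = A da + B db`) on the OPEN triangle only — by continuity of `G` and `G = 0` on `(0, 1/3)`. [folklore] -/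
theorem green_identity (hA : ContinuousOn A Δc) (hB : ContinuousOn B Δc)
    (hS : ∀ p : Fin 2 → ℝ, 0 < p 0 → 0 < p 1 → p 0 + p 1 < 1 → HasFDerivAt S (Lform A B p) p) :
    (∫ t in (0 : ℝ)..1, A ![t, 0]) + (∫ t in (0 : ℝ)..1, (B ![1 - t, t] - A ![1 - t, t])) -
      ∫ t in (0 : ℝ)..1, B ![0, t] = 0 := by
  have hcl : IsClosed {x | G A B x = 0} := isClosed_eq (continuous_G hA hB) continuous_const
  have hsub : Ioo (0 : ℝ) (1 / 3) ⊆ {x | G A B x = 0} := fun x hx => G_eq_zero_of_mem hA hB hS hx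
  have h0 : (0 : ℝ) ∈ closure (Ioo (0 : ℝ) (1 / 3)) := by
    rw [closure_Ioo (by norm_num)]; exact ⟨le_rfl, by norm_num⟩
  have : G A B 0 = 0 := hcl.closure_subset_iff.2 hsub h0
  rwa [G_zero] at this

end GreenSound

/-! ### From interval integrals to values of 1-dimensional representations -/

/-- Transfer `ℝ¹ → ℝ`: the set integral over `{x | x 0 ∈ (0,1)}` of `h (x 0)` is the interval integral `∫₀¹ h`. [folklore] -/
theorem setIntegral_fin_one_eq_intervalIntegral (h : ℝ → ℝ) :
    ∫ x in {x : Fin 1 → ℝ | x 0 ∈ Ioo (0 : ℝ) 1}, h (x 0) = ∫ s in (0 : ℝ)..1, h s := by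
  have hmp := MeasureTheory.volume_preserving_funUnique (Fin 1) ℝ
  have hpre : {x : Fin 1 → ℝ | x 0 ∈ Ioo (0 : ℝ) 1} =
      MeasurableEquiv.funUnique (Fin 1) ℝ ⁻¹' Ioo 0 1 := by
    ext x
    simp [MeasurableEquiv.funUnique, Fin.default_eq_zero]
  have h1 := hmp.setIntegral_preimage_emb (MeasurableEquiv.measurableEmbedding _) h (Ioo 0 1)
  rw [hpre, intervalIntegral.integral_of_le zero_le_one, integral_Ioc_eq_integral_Ioo, ← h1]
  rfl

/-- The unit interval of `ℝ¹` is measurable. [folklore] -/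
theorem measurableSet_fin_one_Ioo : MeasurableSet {x : Fin 1 → ℝ | x 0 ∈ Ioo (0 : ℝ) 1} :=
  (measurable_pi_apply 0) measurableSet_Ioo

/-- The value of a 1-dimensional representation on `(0,1)` with integrand `h (z 0)` is `∫₀¹ h`. [folklore] -/
theorem value_eq_intervalIntegral (r : KZ.IntegralRep 1) (h : ℝ → ℝ)
    (hd : r.domain = {z | z 0 ∈ Set.Ioo 0 1}) (hi : ∀ z ∈ r.domain, r.integrand z = h (z 0)) :
    r.value = ∫ s in (0 : ℝ)..1, h s := by
  rw [KZ.IntegralRep.value, hd, ← setIntegral_fin_one_eq_intervalIntegral]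
  refine setIntegral_congr_fun measurableSet_fin_one_Ioo fun z hz => ?_
  exact hi z (hd ▸ hz)

end Summit.KontsevichZagierPeriods.SymplecticScissors.CurvePeriodsTransferNegative

end
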